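import Summits.Langlands.Langlands.Theses.SkinnerWilesDefectOne
import Summits.Langlands.Langlands.Theorems.SkinnerWilesDefectOneProModularOrdinaryClassicalExitFromNonCMCore
import Summits.Langlands.Langlands.Theorems.SkinnerWilesDefectOneProModularOrdinaryClassicalOfBianchiFinitenessHidaFinite

/-!
# Route `SkinnerWilesDefectOne`, crux `ProModularOrdinaryClassical` (stmt-Langlands-12921): the rev-7 EXIT —
# the glue item `ProModularOrdinaryClassicalGivenBianchiFiniteness` from the non-CM core and SIX printed facts

Helper file (`--supports stmt-Langlands-12921`) of the checked skeleton
`Cruxes/ProModularOrdinaryClassical/Lines/top_degree_exact_control.lean`, rev 7 (lead prover-line-stmt-Langlands-12921-c3-0).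
Rev 7 rewired the line's Borel–Serre fact-stub (ALL `n`, ALL number fields:
`Literature.NumberTheory.Automorphic.BorelSerre1973_finite_groupCohomology_congruenceSubgroup`) to the route's own crux #7
`BianchiCongruenceCohomologyFinite` (stmt-Langlands-15362: congruence subgroups of `GL₂` over IMAGINARY QUADRATIC fields,
finite coefficients), and the route carries the glue item `ProModularOrdinaryClassicalGivenBianchiFiniteness :=
BianchiCongruenceCohomologyFinite → ProModularOrdinaryClassical` (stmt-Langlands-15365).  This file is lead c2's composed exit
`proModularOrdinaryClassical_of_ordinaryFactorisationIwahoriNonCM` (p111700, SEVEN facts) with the Borel–Serre fact REMOVED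
from the hypotheses and the conclusion replaced by the glue item — i.e. the statement a planner's `@[conjecture]` bridge for the
open core closes the glue item (and, the day crux #7 lands, the crux) from, in one line:

`proModularOrdinaryClassicalGivenBianchiFiniteness_of_ordinaryFactorisationIwahoriNonCM`:
  six printed named facts (cuspidal cyclic automorphic induction, Arthur–Clozel Ch. 3 Thm. 6.2/Lemma 6.4; Henniart's
  archimedean components of an automorphic induction; existence of infinity types, Clozel §3.3; Hida control for dominant
  ordinary points; Eichler–Shimura–Harder for interior Bianchi eigenclasses; reducibility of boundary eigensystems)
  → (OF_Iw-nonCM: the registered open core `stub_ordinaryFactorisationIwahoriNonCM` VERBATIM — for NON-CM `ρ`, pro-modular +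
    Galois-ordinary of parallel weight `k ≥ 2` ⇒ a continuous slope-zero point of the Iwahori-level big Hecke algebra at a tame
    level maximal above `p`, associated with `ρ`, with finite-order slot-`0` diamond character; ordinary local–global
    compatibility for completed cohomology of `GL₂` over an imaginary quadratic field in the Galois ⇒ Hecke direction, OPEN)
  → `ProModularOrdinaryClassicalGivenBianchiFiniteness`.

The finiteness of the Hida tower's `ℤ/p^s`-cohomology that Khare–Thorne's Lemma 2.10 (`stub_slopeZeroFactorisation`, p98105)
consumes is taken from the glue item's hypothesis `BianchiCongruenceCohomologyFinite` through the landed rewiring certificate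
`BianchiFiniteness.hidaCohomology_finite_of_bianchi` (in-tree Shapiro over the finitely many components), at the crux's
imaginary quadratic `F` only.  Everything else is as in p111700: CM regime by `stub_cmInducedCuspidal` (p105721) +
`stub_cmSatakeFrobGlue` (p106683); non-CM regime by the transfer hypothesis, KT 2.10, transport of association and diamond
values along `toOrd`, and `classical_of_ordinaryPoint` (p96987).  Pure logic over landed files; no new mathematics; no
definitions.  What is NOT here: any claim on the open core (see `Cruxes/ProModularOrdinaryClassical/OPEN-CORE-c3.md`).
-/

noncomputable section

namespace Summit.Langlands.Langlands.Cruxes.ProModularOrdinaryClassical.TopDegreeExactControl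

set_option linter.dupNamespace false

open Summit.Langlands.Langlands.Theses.SkinnerWilesDefectOne
open Summit.Langlands.Langlands.Theorems.SkinnerWilesDefectOne.BianchiFiniteness
open Literature.NumberTheory.Automorphic Literature.NumberTheory.GaloisRepresentations
open Literature.NumberTheory.Automorphic.BigHeckeGLn
open NumberField IsDedekindDomain Filter Polynomial
open scoped Classical

/-- **The glue item `ProModularOrdinaryClassicalGivenBianchiFiniteness` from the non-CM ordinary factorisation core and six
printed facts** (the line `top-degree-exact-control`, rev 7, composed once).  Case split on the automorphic shape of `ρ`
through `ι`: (CM) `ρ` has a.e. the Frobenius polynomials induced from a regular algebraic Hecke character `θ` of a quadratic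
`K/F` ⇒ cuspidal automorphic induction of `θ` is L-algebraic with the induced Satake polynomials (`stub_cmInducedCuspidal`,
modulo the first three facts) and matches `ρ` (`stub_cmSatakeFrobGlue`); (non-CM) the transfer hypothesis gives a slope-zero
Iwahori point, Khare–Thorne Lemma 2.10 (`stub_slopeZeroFactorisation`, with finiteness of the tower's cohomology from the glue
item's hypothesis `BianchiCongruenceCohomologyFinite` via `hidaCohomology_finite_of_bianchi`) factors it through Hida's
ordinary algebra, association and diamond values transfer along `toOrd`, and the landed exit `classical_of_ordinaryPoint`
(modulo the last three facts) gives the L-algebraic cuspidal `π` with the summit's Satake–Frobenius clause. [folklore] -/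
theorem proModularOrdinaryClassicalGivenBianchiFiniteness_of_ordinaryFactorisationIwahoriNonCM : Literature.NumberTheory.Automorphic.automorphicInduction_cyclic_cuspidal → Literature.NumberTheory.Automorphic.Henniart2012_infinityType_of_automorphicInduction → (∀ (n : ℕ) (K : Type) [Field K] [NumberField K] (hK : Literature.NumberTheory.Automorphic.isCompact_glFiniteIntegralLevel n K) (π : Literature.NumberTheory.Automorphic.AutomorphicRepData (Literature.NumberTheory.Automorphic.AutomorphyDatum.gl n K hK)), π.exists_hasInfinityType) → Literature.NumberTheory.Automorphic.hidaControl_dominantOrdinaryPoint → Literature.NumberTheory.Automorphic.bianchi_interiorEigenclass_isCuspidal → Literature.NumberTheory.Automorphic.bianchi_boundaryEigensystem_isReducible → (∀ (F : Type) [Field F] [NumberField F], NumberField.IsTotallyComplex F → Module.finrank ℚ F = 2 → ∀ (p : ℕ) [Fact p.Prime], p ≠ 2 → ∀ (ι : PadicAlgCl p ≃+* ℂ) (ρ : Literature.NumberTheory.GaloisRepresentations.FramedGaloisRep F (PadicAlgCl p) 2) (k m : ℕ), ρ.toGaloisRep.IsIrreducible → (¬ ∃ (K : Type) (_ : Field K)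 (_ : NumberField K) (_ : Algebra F K) (_ : Module.finrank F K = 2) (θ : Literature.NumberTheory.GaloisRepresentations.HeckeCharacter K), θ.IsAlgebraic ∧ (∃ᶠ w : IsDedekindDomain.HeightOneSpectrum (NumberField.RingOfIntegers K) in Filter.cofinite, ∃ w' : IsDedekindDomain.HeightOneSpectrum (NumberField.RingOfIntegers K), w'.asIdeal.under (NumberField.RingOfIntegers F) = w.asIdeal.under (NumberField.RingOfIntegers F) ∧ θ.valueAtUniformizer w' ≠ θ.valueAtUniformizer w) ∧ ∀ᶠ v : IsDedekindDomain.HeightOneSpectrum (NumberField.RingOfIntegers F) in Filter.cofinite, ρ.IsUnramifiedAt v ∧ ρ.HasFrobCharpolyAt v (∏ᶠ w ∈ {w : IsDedekindDomain.HeightOneSpectrum (NumberField.RingOfIntegers K) | w.under (NumberField.RingOfIntegers F) = v}, (Polynomial.X ^ w.asIdeal.inertiaDeg (NumberField.RingOfIntegers F) - Polynomial.C (ι.symm (θ.valueAtUniformizer w)⁻¹)))) → (∀ᶠ v in Filter.cofinite, ρ.IsUnramifiedAt v) → (∃ 𝒰 : Literature.NumberTheory.Automorphic.BigHeckeGLn.TameLevel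 2 F p, 𝒰.IsPadicallyAutomorphic ρ) → 2 ≤ k → 0 < m → (∀ v : IsDedekindDomain.HeightOneSpectrum (NumberField.RingOfIntegers F), (p : NumberField.RingOfIntegers F) ∈ v.asIdeal → ρ.IsOrdinaryOfWeightAt p v k m) → ∃ 𝒰 : Literature.NumberTheory.Automorphic.BigHeckeGLn.TameLevel 2 F p, 𝒰.IsMaximalAbove ∧ ∃ y : Literature.NumberTheory.Automorphic.HidaHeckeAlgebraGLn 𝒰 →+* PadicAlgCl p, Continuous y ∧ 𝒰.IsHidaAssociated y ρ ∧ (∀ v : IsDedekindDomain.HeightOneSpectrum (NumberField.RingOfIntegers F), (p : NumberField.RingOfIntegers F) ∈ v.asIdeal → 𝒰.IsSlopeZeroAt y v) ∧ ∃ N : ℕ, 0 < N ∧ ∀ (u : NumberField.RingOfIntegers F) (û : ∀ v : IsDedekindDomain.HeightOneSpectrum (NumberField.RingOfIntegers F), (p : NumberField.RingOfIntegers F) ∈ v.asIdeal → (v.adicCompletionIntegers F)ˣ), (∀ (v : IsDedekindDomain.HeightOneSpectrum (NumberField.RingOfIntegers F)) (hv : (p : NumberField.RingOfIntegers F) ∈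 v.asIdeal), ((û v hv : v.adicCompletionIntegers F) : v.adicCompletion F) = algebraMap F (v.adicCompletion F) (u : F)) → (∏ᶠ v : {v : IsDedekindDomain.HeightOneSpectrum (NumberField.RingOfIntegers F) // (p : NumberField.RingOfIntegers F) ∈ v.asIdeal}, y (𝒰.hidaDiamond v.2 (Pi.mulSingle (0 : Fin 2) (û v.1 v.2)))) ^ N = 1) → Summit.Langlands.Langlands.Theses.SkinnerWilesDefectOne.ProModularOrdinaryClassicalGivenBianchiFiniteness := by
  intro hAI hHen hIT hA hB hC hOF hBianchi F _ _ hF hdeg p _ hp hcpt ι ρ hirr hunr hpm hord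
  by_cases hcm : ∃ (K : Type) (_ : Field K) (_ : NumberField K) (_ : Algebra F K) (_ : Module.finrank F K = 2)
      (θ : HeckeCharacter K), θ.IsAlgebraic ∧
        (∃ᶠ w : HeightOneSpectrum (𝓞 K) in cofinite, ∃ w' : HeightOneSpectrum (𝓞 K),
          w'.asIdeal.under (𝓞 F) = w.asIdeal.under (𝓞 F) ∧ θ.valueAtUniformizer w' ≠ θ.valueAtUniformizer w) ∧
        ∀ᶠ v : HeightOneSpectrum (𝓞 F) in cofinite, ρ.IsUnramifiedAt v ∧
          ρ.HasFrobCharpolyAt v (∏ᶠ w ∈ {w : HeightOneSpectrum (𝓞 K) | w.under (𝓞 F) = v},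
            (X ^ w.asIdeal.inertiaDeg (𝓞 F) - C (ι.symm (θ.valueAtUniformizer w)⁻¹)))
  · -- the CM regime: cuspidal automorphic induction of `θ`, no transfer hypothesis and no finiteness needed
    obtain ⟨K, iK, iN, iA, hK, θ, halg, hreg, hfrob⟩ := hcm
    obtain ⟨π, hLalg, hsat⟩ := @stub_cmInducedCuspidal hAI hHen hIT F _ _ hcpt K iK iN iA hK θ halg hreg
    exact ⟨π, hLalg, @stub_cmSatakeFrobGlue F _ _ p _ hcpt ι ρ K iK iN iA hK θ π hsat hfrob⟩
  · -- the non-CM regime: transfer hypothesis + KT 2.10 + finiteness from the glue item's hypothesis, then the landed exit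
    obtain ⟨k, hk, m, hm, hv⟩ := hord
    obtain ⟨𝒰, h𝒰, y, hy, hass, hslope, N, hN, hslot⟩ := hOF F hF hdeg p hp ι ρ k m hirr hcm hunr hpm hk hm hv
    have hfin : ∀ ι : TowerIndex, Finite (𝒰.hidaCohomology ℤ ι) :=
      hidaCohomology_finite_of_bianchi hBianchi F hdeg hF p 𝒰
    obtain ⟨x, hx, hxy⟩ := stub_slopeZeroFactorisation F p 𝒰 h𝒰 hfin y hy hslope
    have hass' : 𝒰.IsOrdAssociated x ρ := by
      have hfun : (fun w j => x (𝒰.ordT w j)) = fun w j => y (𝒰.hidaT w j) := by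
        funext w j
        rw [← hxy, RingHom.comp_apply, TameLevel.toOrd_hidaT]
      show IsAssociatedFamily 2 𝒰.bad (fun w j => x (𝒰.ordT w j)) ρ
      rw [hfun]
      exact hass
    have hslot' : ∃ N : ℕ, 0 < N ∧ ∀ (u : 𝓞 F)
        (û : ∀ v : HeightOneSpectrum (𝓞 F), (p : 𝓞 F) ∈ v.asIdeal → (v.adicCompletionIntegers F)ˣ),
        (∀ (v : HeightOneSpectrum (𝓞 F)) (hv : (p : 𝓞 F) ∈ v.asIdeal),
            ((û v hv : v.adicCompletionIntegers F) : v.adicCompletion F) =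
              algebraMap F (v.adicCompletion F) (u : F)) →
        (∏ᶠ v : {v : HeightOneSpectrum (𝓞 F) // (p : 𝓞 F) ∈ v.asIdeal},
            x (𝒰.ordDiamond v.2 (Pi.mulSingle (0 : Fin 2) (û v.1 v.2)))) ^ N = 1 := by
      refine ⟨N, hN, fun u û hû => ?_⟩
      have hdia : ∀ v : {v : HeightOneSpectrum (𝓞 F) // (p : 𝓞 F) ∈ v.asIdeal},
          x (𝒰.ordDiamond v.2 (Pi.mulSingle (0 : Fin 2) (û v.1 v.2))) =
            y (𝒰.hidaDiamond v.2 (Pi.mulSingle (0 : Fin 2) (û v.1 v.2))) := by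
        intro v
        rw [← hxy, RingHom.comp_apply, TameLevel.toOrd_hidaDiamond]
      simp only [hdia]
      exact hslot u û hû
    exact classical_of_ordinaryPoint hA hB hC F hF hdeg p hp hcpt ι ρ 𝒰 x k m hirr h𝒰 hx hass' hk hm hv hslot'

/-- **Hence, with crux #7, the crux itself** from the non-CM core and the six printed facts: the rev-7 skeleton's composition
as one importable implication (`BianchiCongruenceCohomologyFinite` = route item stmt-Langlands-15362, taken as a hypothesis;
it is discharged by name when that item closes). [folklore] -/
theorem proModularOrdinaryClassical_of_bianchiFinite_of_ordinaryFactorisationIwahoriNonCM : Summit.Langlands.Langlands.Theses.SkinnerWilesDefectOne.BianchiCongruenceCohomologyFinite → Literature.NumberTheory.Automorphic.automorphicInduction_cyclic_cuspidal → Literature.NumberTheory.Automorphic.Henniart2012_infinityType_of_automorphicInduction → (∀ (n : ℕ) (K : Type) [Field K] [NumberField K] (hK : Literature.NumberTheory.Automorphic.isCompact_glFiniteIntegralLevel n K) (π : Literature.NumberTheory.Automorphic.AutomorphicRepData (Literature.NumberTheory.Automorphic.AutomorphyDatum.gl n K hK)), π.exists_hasInfinityType) → Literature.NumberTheory.Automorphic.hidaControl_dominantOrdinaryPoint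 → Literature.NumberTheory.Automorphic.bianchi_interiorEigenclass_isCuspidal → Literature.NumberTheory.Automorphic.bianchi_boundaryEigensystem_isReducible → (∀ (F : Type) [Field F] [NumberField F], NumberField.IsTotallyComplex F → Module.finrank ℚ F = 2 → ∀ (p : ℕ) [Fact p.Prime], p ≠ 2 → ∀ (ι : PadicAlgCl p ≃+* ℂ) (ρ : Literature.NumberTheory.GaloisRepresentations.FramedGaloisRep F (PadicAlgCl p) 2) (k m : ℕ), ρ.toGaloisRep.IsIrreducible → (¬ ∃ (K : Type) (_ : Field K) (_ : NumberField K) (_ : Algebra F K) (_ : Module.finrank F K = 2) (θ : Literature.NumberTheory.GaloisRepresentations.HeckeCharacter K), θ.IsAlgebraic ∧ (∃ᶠ w : IsDedekindDomain.HeightOneSpectrum (NumberField.RingOfIntegers K) in Filter.cofinite, ∃ w' : IsDedekindDomain.HeightOneSpectrum (NumberField.RingOfIntegers K), w'.asIdeal.under (NumberField.RingOfIntegers F) = w.asIdeal.under (NumberField.RingOfIntegers F) ∧ θ.valueAtUniformizer w' ≠ θ.valueAtUniformizer w) ∧ ∀ᶠ v : IsDedekindDomain.HeightOneSpectrum (NumberField.RingOfIntegers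 F) in Filter.cofinite, ρ.IsUnramifiedAt v ∧ ρ.HasFrobCharpolyAt v (∏ᶠ w ∈ {w : IsDedekindDomain.HeightOneSpectrum (NumberField.RingOfIntegers K) | w.under (NumberField.RingOfIntegers F) = v}, (Polynomial.X ^ w.asIdeal.inertiaDeg (NumberField.RingOfIntegers F) - Polynomial.C (ι.symm (θ.valueAtUniformizer w)⁻¹)))) → (∀ᶠ v in Filter.cofinite, ρ.IsUnramifiedAt v) → (∃ 𝒰 : Literature.NumberTheory.Automorphic.BigHeckeGLn.TameLevel 2 F p, 𝒰.IsPadicallyAutomorphic ρ) → 2 ≤ k → 0 < m → (∀ v : IsDedekindDomain.HeightOneSpectrum (NumberField.RingOfIntegers F), (p : NumberField.RingOfIntegers F) ∈ v.asIdeal → ρ.IsOrdinaryOfWeightAt p v k m) → ∃ 𝒰 : Literature.NumberTheory.Automorphic.BigHeckeGLn.TameLevel 2 F p, 𝒰.IsMaximalAbove ∧ ∃ y : Literature.NumberTheory.Automorphic.HidaHeckeAlgebraGLn 𝒰 →+* PadicAlgCl p, Continuous y ∧ 𝒰.IsHidaAssociated y ρ ∧ (∀ v : IsDedekindDomain.HeightOneSpectrum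 (NumberField.RingOfIntegers F), (p : NumberField.RingOfIntegers F) ∈ v.asIdeal → 𝒰.IsSlopeZeroAt y v) ∧ ∃ N : ℕ, 0 < N ∧ ∀ (u : NumberField.RingOfIntegers F) (û : ∀ v : IsDedekindDomain.HeightOneSpectrum (NumberField.RingOfIntegers F), (p : NumberField.RingOfIntegers F) ∈ v.asIdeal → (v.adicCompletionIntegers F)ˣ), (∀ (v : IsDedekindDomain.HeightOneSpectrum (NumberField.RingOfIntegers F)) (hv : (p : NumberField.RingOfIntegers F) ∈ v.asIdeal), ((û v hv : v.adicCompletionIntegers F) : v.adicCompletion F) = algebraMap F (v.adicCompletion F) (u : F)) → (∏ᶠ v : {v : IsDedekindDomain.HeightOneSpectrum (NumberField.RingOfIntegers F) // (p : NumberField.RingOfIntegers F) ∈ v.asIdeal}, y (𝒰.hidaDiamond v.2 (Pi.mulSingle (0 : Fin 2) (û v.1 v.2)))) ^ N = 1) → Summit.Langlands.Langlands.Theses.SkinnerWilesDefectOne.ProModularOrdinaryClassical :=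
  fun hBianchi hAI hHen hIT hA hB hC hOF =>
    proModularOrdinaryClassicalGivenBianchiFiniteness_of_ordinaryFactorisationIwahoriNonCM hAI hHen hIT hA hB hC hOF hBianchi

end Summit.Langlands.Langlands.Cruxes.ProModularOrdinaryClassical.TopDegreeExactControl

end
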